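import Summits.QuantumFields.YangMills.Theorems.UnitScaleTiltProp7PowerSeriesSecondDiff
import Literature.Analysis.Calculus.ExpDifferentialAdSeries
import HarnessLib

/-!
# Prop 7, route-R E′, (E1-c) brick F3b(ii) — TAYLOR-2 WORDS OF `exp`: `e^{x+k} − e^x − Dexp_x(k)`, ITS SIZE, `k`-LIPSCHITZ AND `x`-LIPSCHITZ ROWS (C^{2,1} of `exp`, constants `e^{R+K}`)

Route `UnitScaleTilt`, crux K1 child «MinimiserStabilityRegPr» (`stmt-QuantumFields-19200`), cell ym3-torus, width seat px15 (gen 2); pen «px15 g2: (E1-c) GO-LOCATE» (★p1 g15,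
2026-08-28T20:45:05Z), LOCATE `LOCATE-E1C-DIVLIPSCHITZ-px15g2.md` §6 (ORDER COUNT: the contraction's `hN` is a second difference of the chart remainder, so the pure-gauge piece
needs THREE derivatives of `exp`).  THEOREMS ONLY (0 `def`, 0 `sorry`); `--supports stmt-QuantumFields-19200`, count-neutral.  YM₃ on T³ is a ladder rung (R3), not the Clay problem;
nothing here claims the stub, the crux, d = 4 or the mass gap.

THE WORDS.  `L_n(x;k) := Σ_{j<n} x^j k x^{n−1−j}` (so `Σ_n L_n∕n! = Dexp_x(k)`, ✓ `ExpDifferential.dexp_apply_eq_tsum`) and the Taylor-2 word `T_n(x;k) := (x+k)ⁿ − xⁿ − L_n(x;k)`,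
written OUT (no definitions).  §1 the recurrences `L_{n+1} = x·L_n + k·xⁿ`, **`T_{n+1} = x·T_n + k·((x+k)ⁿ − xⁿ)`**, `T_0 = T_1 = 0`, `T_2 = k²`, `T_3 = xk² + kxk + k²x + k³`.
§2 by induction, for `‖x‖,‖x′‖ ≤ R`, `‖k‖,‖k′‖ ≤ K`, `ρ = R + K`: (α) `‖T_{n+2}(x;k)‖ ≤ ½(n+2)(n+1)ρⁿK²`; (β) `‖T_{n+2}(x;k) − T_{n+2}(x;k′)‖ ≤ (n+2)(n+1)ρⁿK‖k − k′‖`;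
(γ) `‖T_{n+3}(x;k) − T_{n+3}(x′;k)‖ ≤ ⅚(n+3)(n+2)(n+1)ρⁿK²‖x − x′‖` (step via ✓ F3a `norm_pow_secondDiff_le`).  §3 summing with `1∕n!`:
* `hasSum_taylorWord` — `Σ T_n(x;k)∕n! = e^{x+k} − e^x − dexp x k`;
* ★ `norm_expTaylorTwo_le` — `‖e^{x+k} − e^x − dexp x k‖ ≤ e^{R+K}·K²∕2`;
* ★ `norm_expTaylorTwo_sub_expTaylorTwo_le` (`k`-Lipschitz, factor `K`) — `≤ e^{R+K}·K·‖k − k′‖`;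
* ★★ `norm_expTaylorTwo_sub_expTaylorTwo_le'` (`x`-Lipschitz, factor `K²`) — `≤ ⅚e^{R+K}·K²·‖x − x′‖`.
These are the three rows the CRUDE rule (✓ F1 `norm_divB_le_sum`) needs for the `O(δ²)` part of `P₂` (δ = covariant difference, `K ≍ ℓ⁻¹`): no bond-difference of this part is ever taken,
so the mixed four-point row (δ) of the LOCATE is NOT needed.  HONEST SCOPE.  Elementary ([folklore]); constants are not optimised (`⅚` could be `½`).

References: T. Bałaban, CMP 98 (1985) 17–51 [Balaban1985Averaging] ((32)–(34) p.22); B. C. Hall, *Lie Groups, Lie Algebras, and Representations*, 2nd ed. (2015), Thm. 5.4 [Hall2015].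
-/

set_option autoImplicit false

noncomputable section

open NormedSpace Finset
open scoped Nat

namespace Summit.QuantumFields.YangMills.Theorems.Prop7ExpTaylorTwo

open Literature.Analysis.Calculus.ExpDifferential (dexp dexp_apply_eq_tsum)
open YMDAG.N18.TransportOfRecord (norm_pow_succ_sub_pow_succ_le_of_le)
open Summit.QuantumFields.YangMills.Theorems.Prop7PowerSeriesSecondDiff (norm_pow_secondDiff_le)

variable {E : Type*} [NormedRing E] [NormedAlgebra ℂ E] [CompleteSpace E]

/-! ## §1 The word recurrences -/

omit [NormedAlgebra ℂ E] [CompleteSpace E] in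
/-- `L_{n+1}(x;k) = x·L_n(x;k) + k·xⁿ`. [folklore] -/
theorem linWord_succ (x k : E) (n : ℕ) :
    ∑ j ∈ range (n + 1), x ^ j * k * x ^ (n + 1 - 1 - j) = x * ∑ j ∈ range n, x ^ j * k * x ^ (n - 1 - j) + k * x ^ n := by
  rw [sum_range_succ', mul_sum]
  congr 1
  · refine sum_congr rfl fun j hj => ?_
    have hj' : j < n := mem_range.mp hj
    have e : n + 1 - 1 - (j + 1) = n - 1 - j := by omega
    rw [e, pow_succ']
    simp only [mul_assoc]
  · simp

omit [NormedAlgebra ℂ E] [CompleteSpace E] in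
/-- **THE TAYLOR-2 WORD RECURRENCE** `T_{n+1}(x;k) = x·T_n(x;k) + k·((x+k)ⁿ − xⁿ)`. [folklore] -/
theorem taylorWord_succ (x k : E) (n : ℕ) :
    (x + k) ^ (n + 1) - x ^ (n + 1) - ∑ j ∈ range (n + 1), x ^ j * k * x ^ (n + 1 - 1 - j)
      = x * ((x + k) ^ n - x ^ n - ∑ j ∈ range n, x ^ j * k * x ^ (n - 1 - j)) + k * ((x + k) ^ n - x ^ n) := by
  rw [linWord_succ, pow_succ', pow_succ']
  generalize (x + k) ^ n = A
  generalize x ^ n = B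
  generalize ∑ j ∈ range n, x ^ j * k * x ^ (n - 1 - j) = S
  noncomm_ring

omit [NormedAlgebra ℂ E] [CompleteSpace E] in
/-- `T_2(x;k) = k²`. [folklore] -/
theorem taylorWord_two (x k : E) : (x + k) ^ 2 - x ^ 2 - ∑ j ∈ range 2, x ^ j * k * x ^ (2 - 1 - j) = k * k := by
  simp only [sum_range_succ, sum_range_zero, zero_add, pow_zero, one_mul, Nat.sub_self, pow_one, mul_one,
    show (2 : ℕ) - 1 - 0 = 1 from rfl]
  noncomm_ring

omit [NormedAlgebra ℂ E] [CompleteSpace E] in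
/-- `T_3(x;k) = xk² + kxk + k²x + k³`. [folklore] -/
theorem taylorWord_three (x k : E) :
    (x + k) ^ 3 - x ^ 3 - ∑ j ∈ range 3, x ^ j * k * x ^ (3 - 1 - j) = x * k * k + k * x * k + k * k * x + k * k * k := by
  simp only [sum_range_succ, sum_range_zero, zero_add, pow_zero, one_mul, pow_one, mul_one,
    show (3 : ℕ) - 1 - 0 = 2 from rfl, show (3 : ℕ) - 1 - 1 = 1 from rfl, show (3 : ℕ) - 1 - 2 = 0 from rfl]
  noncomm_ring

/-! ## §2 Norm rows of the words -/

omit [NormedAlgebra ℂ E] [CompleteSpace E] in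
/-- (α) SIZE: `‖T_{n+2}(x;k)‖ ≤ ½(n+2)(n+1)(R+K)ⁿK²`. [folklore] -/
theorem norm_taylorWord_le {x k : E} {R K : ℝ} (hx : ‖x‖ ≤ R) (hk : ‖k‖ ≤ K) :
    ∀ n : ℕ, ‖(x + k) ^ (n + 2) - x ^ (n + 2) - ∑ j ∈ range (n + 2), x ^ j * k * x ^ (n + 2 - 1 - j)‖
      ≤ (n + 2) * (n + 1) / 2 * (R + K) ^ n * K ^ 2
  | 0 => by
    rw [show 0 + 2 = 2 from rfl, taylorWord_two]
    have hK : 0 ≤ K := (norm_nonneg k).trans hk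
    calc ‖k * k‖ ≤ ‖k‖ * ‖k‖ := norm_mul_le _ _
      _ ≤ K * K := mul_le_mul hk hk (norm_nonneg _) hK
      _ = ((0 : ℕ) + 2 : ℝ) * ((0 : ℕ) + 1) / 2 * (R + K) ^ 0 * K ^ 2 := by push_cast; ring
  | n + 1 => by
    have hR : 0 ≤ R := (norm_nonneg x).trans hx
    have hK : 0 ≤ K := (norm_nonneg k).trans hk
    have hxk : ‖x + k‖ ≤ R + K := (norm_add_le _ _).trans (add_le_add hx hk)
    have hxρ : ‖x‖ ≤ R + K := hx.trans (le_add_of_nonneg_right hK)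
    have ih := norm_taylorWord_le hx hk n
    rw [show n + 1 + 2 = n + 2 + 1 from rfl, taylorWord_succ x k (n + 2)]
    have h1 := norm_pow_succ_sub_pow_succ_le_of_le hxk hxρ (n + 1)
    rw [add_sub_cancel_left] at h1
    have hpd : ‖(x + k) ^ (n + 2) - x ^ (n + 2)‖ ≤ (n + 2) * (R + K) ^ (n + 1) * K := by
      refine h1.trans ?_
      push_cast
      have : ((n : ℝ) + 1 + 1) * (R + K) ^ (n + 1) * ‖k‖ ≤ ((n : ℝ) + 1 + 1) * (R + K) ^ (n + 1) * K :=
        mul_le_mul_of_nonneg_left hk (by positivity)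
      linarith
    have hRρ : R * (R + K) ^ n ≤ (R + K) ^ (n + 1) := by
      rw [pow_succ, mul_comm]
      exact mul_le_mul_of_nonneg_left (le_add_of_nonneg_right hK) (pow_nonneg (add_nonneg hR hK) n)
    have key : (n + 2) * (n + 1) / 2 * K ^ 2 * (R * (R + K) ^ n) ≤ (n + 2) * (n + 1) / 2 * K ^ 2 * (R + K) ^ (n + 1) :=
      mul_le_mul_of_nonneg_left hRρ (by positivity)
    calc ‖x * ((x + k) ^ (n + 2) - x ^ (n + 2) - ∑ j ∈ range (n + 2), x ^ j * k * x ^ (n + 2 - 1 - j)) + k * ((x + k) ^ (n + 2) - x ^ (n + 2))‖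
        ≤ ‖x‖ * ‖(x + k) ^ (n + 2) - x ^ (n + 2) - ∑ j ∈ range (n + 2), x ^ j * k * x ^ (n + 2 - 1 - j)‖ + ‖k‖ * ‖(x + k) ^ (n + 2) - x ^ (n + 2)‖ :=
          (norm_add_le _ _).trans (add_le_add (norm_mul_le _ _) (norm_mul_le _ _))
      _ ≤ R * ((n + 2) * (n + 1) / 2 * (R + K) ^ n * K ^ 2) + K * ((n + 2) * (R + K) ^ (n + 1) * K) :=
          add_le_add (mul_le_mul hx ih (norm_nonneg _) hR) (mul_le_mul hk hpd (norm_nonneg _) hK)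
      _ ≤ ((n + 1 : ℕ) + 2 : ℝ) * ((n + 1 : ℕ) + 1) / 2 * (R + K) ^ (n + 1) * K ^ 2 := by
          push_cast
          nlinarith [key]

omit [NormedAlgebra ℂ E] [CompleteSpace E] in
/-- (β) `k`-LIPSCHITZ: `‖T_{n+2}(x;k) − T_{n+2}(x;k′)‖ ≤ (n+2)(n+1)(R+K)ⁿK‖k − k′‖`. [folklore] -/
theorem norm_taylorWord_sub_le {x k k' : E} {R K : ℝ} (hx : ‖x‖ ≤ R) (hk : ‖k‖ ≤ K) (hk' : ‖k'‖ ≤ K) :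
    ∀ n : ℕ, ‖((x + k) ^ (n + 2) - x ^ (n + 2) - ∑ j ∈ range (n + 2), x ^ j * k * x ^ (n + 2 - 1 - j))
        - ((x + k') ^ (n + 2) - x ^ (n + 2) - ∑ j ∈ range (n + 2), x ^ j * k' * x ^ (n + 2 - 1 - j))‖
      ≤ (n + 2) * (n + 1) * (R + K) ^ n * K * ‖k - k'‖
  | 0 => by
    rw [show 0 + 2 = 2 from rfl, taylorWord_two, taylorWord_two]
    have hK : 0 ≤ K := (norm_nonneg k).trans hk
    have e : k * k - k' * k' = k * (k - k') + (k - k') * k' := by noncomm_ring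
    rw [e]
    calc ‖k * (k - k') + (k - k') * k'‖ ≤ ‖k‖ * ‖k - k'‖ + ‖k - k'‖ * ‖k'‖ :=
          (norm_add_le _ _).trans (add_le_add (norm_mul_le _ _) (norm_mul_le _ _))
      _ ≤ K * ‖k - k'‖ + ‖k - k'‖ * K :=
          add_le_add (mul_le_mul_of_nonneg_right hk (norm_nonneg _)) (mul_le_mul_of_nonneg_left hk' (norm_nonneg _))
      _ = ((0 : ℕ) + 2 : ℝ) * ((0 : ℕ) + 1) * (R + K) ^ 0 * K * ‖k - k'‖ := by push_cast; ring
  | n + 1 => by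
    have hR : 0 ≤ R := (norm_nonneg x).trans hx
    have hK : 0 ≤ K := (norm_nonneg k).trans hk
    have hρ : 0 ≤ R + K := add_nonneg hR hK
    have hxk : ‖x + k‖ ≤ R + K := (norm_add_le _ _).trans (add_le_add hx hk)
    have hxk' : ‖x + k'‖ ≤ R + K := (norm_add_le _ _).trans (add_le_add hx hk')
    have hxρ : ‖x‖ ≤ R + K := hx.trans (le_add_of_nonneg_right hK)
    have ih := norm_taylorWord_sub_le hx hk hk' n
    rw [show n + 1 + 2 = n + 2 + 1 from rfl, taylorWord_succ x k (n + 2), taylorWord_succ x k' (n + 2)]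
    set T := (x + k) ^ (n + 2) - x ^ (n + 2) - ∑ j ∈ range (n + 2), x ^ j * k * x ^ (n + 2 - 1 - j) with hT
    set T' := (x + k') ^ (n + 2) - x ^ (n + 2) - ∑ j ∈ range (n + 2), x ^ j * k' * x ^ (n + 2 - 1 - j) with hT'
    have e : x * T + k * ((x + k) ^ (n + 2) - x ^ (n + 2)) - (x * T' + k' * ((x + k') ^ (n + 2) - x ^ (n + 2)))
        = x * (T - T') + ((k - k') * ((x + k) ^ (n + 2) - x ^ (n + 2)) + k' * ((x + k) ^ (n + 2) - (x + k') ^ (n + 2))) := by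
      noncomm_ring
    rw [e]
    have h1 := norm_pow_succ_sub_pow_succ_le_of_le hxk hxρ (n + 1)
    rw [add_sub_cancel_left] at h1
    have h2 := norm_pow_succ_sub_pow_succ_le_of_le hxk hxk' (n + 1)
    rw [add_sub_add_left_eq_sub] at h2
    have hpd : ‖(x + k) ^ (n + 2) - x ^ (n + 2)‖ ≤ (n + 2) * (R + K) ^ (n + 1) * K := by
      refine h1.trans ?_
      push_cast
      have : ((n : ℝ) + 1 + 1) * (R + K) ^ (n + 1) * ‖k‖ ≤ ((n : ℝ) + 1 + 1) * (R + K) ^ (n + 1) * K :=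
        mul_le_mul_of_nonneg_left hk (by positivity)
      linarith
    have hpd' : ‖(x + k) ^ (n + 2) - (x + k') ^ (n + 2)‖ ≤ (n + 2) * (R + K) ^ (n + 1) * ‖k - k'‖ := by
      refine h2.trans (le_of_eq ?_)
      push_cast
      ring
    have hRρ : R * (R + K) ^ n ≤ (R + K) ^ (n + 1) := by
      rw [pow_succ, mul_comm]
      exact mul_le_mul_of_nonneg_left (le_add_of_nonneg_right hK) (pow_nonneg hρ n)
    have key : (n + 2) * (n + 1) * K * ‖k - k'‖ * (R * (R + K) ^ n) ≤ (n + 2) * (n + 1) * K * ‖k - k'‖ * (R + K) ^ (n + 1) :=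
      mul_le_mul_of_nonneg_left hRρ (by positivity)
    have hkk : 0 ≤ ‖k - k'‖ := norm_nonneg _
    calc ‖x * (T - T') + ((k - k') * ((x + k) ^ (n + 2) - x ^ (n + 2)) + k' * ((x + k) ^ (n + 2) - (x + k') ^ (n + 2)))‖
        ≤ ‖x‖ * ‖T - T'‖ + (‖k - k'‖ * ‖(x + k) ^ (n + 2) - x ^ (n + 2)‖ + ‖k'‖ * ‖(x + k) ^ (n + 2) - (x + k') ^ (n + 2)‖) :=
          (norm_add_le _ _).trans (add_le_add (norm_mul_le _ _)
            ((norm_add_le _ _).trans (add_le_add (norm_mul_le _ _) (norm_mul_le _ _))))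
      _ ≤ R * ((n + 2) * (n + 1) * (R + K) ^ n * K * ‖k - k'‖)
          + (‖k - k'‖ * ((n + 2) * (R + K) ^ (n + 1) * K) + K * ((n + 2) * (R + K) ^ (n + 1) * ‖k - k'‖)) :=
          add_le_add (mul_le_mul hx ih (norm_nonneg _) hR)
            (add_le_add (mul_le_mul_of_nonneg_left hpd hkk) (mul_le_mul hk' hpd' (norm_nonneg _) hK))
      _ ≤ ((n + 1 : ℕ) + 2 : ℝ) * ((n + 1 : ℕ) + 1) * (R + K) ^ (n + 1) * K * ‖k - k'‖ := by
          push_cast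
          nlinarith [key]

omit [NormedAlgebra ℂ E] [CompleteSpace E] in
/-- (γ) `x`-LIPSCHITZ WITH FACTOR `K²`: `‖T_{n+3}(x;k) − T_{n+3}(x′;k)‖ ≤ ⅚(n+3)(n+2)(n+1)(R+K)ⁿK²‖x − x′‖` (step via F3a's four-point row of powers). [folklore] -/
theorem norm_taylorWord_sub_le' {x x' k : E} {R K : ℝ} (hx : ‖x‖ ≤ R) (hx' : ‖x'‖ ≤ R) (hk : ‖k‖ ≤ K) :
    ∀ n : ℕ, ‖((x + k) ^ (n + 3) - x ^ (n + 3) - ∑ j ∈ range (n + 3), x ^ j * k * x ^ (n + 3 - 1 - j))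
        - ((x' + k) ^ (n + 3) - x' ^ (n + 3) - ∑ j ∈ range (n + 3), x' ^ j * k * x' ^ (n + 3 - 1 - j))‖
      ≤ 5 / 6 * ((n + 3) * (n + 2) * (n + 1)) * (R + K) ^ n * K ^ 2 * ‖x - x'‖
  | 0 => by
    rw [show 0 + 3 = 3 from rfl, taylorWord_three, taylorWord_three]
    have hK : 0 ≤ K := (norm_nonneg k).trans hk
    have e : x * k * k + k * x * k + k * k * x + k * k * k - (x' * k * k + k * x' * k + k * k * x' + k * k * k)
        = (x - x') * k * k + k * (x - x') * k + k * k * (x - x') := by noncomm_ring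
    rw [e]
    have hkk : ‖k‖ * ‖k‖ ≤ K * K := mul_le_mul hk hk (norm_nonneg _) hK
    have h0 : 0 ≤ ‖x - x'‖ := norm_nonneg _
    calc ‖(x - x') * k * k + k * (x - x') * k + k * k * (x - x')‖
        ≤ ‖x - x'‖ * ‖k‖ * ‖k‖ + ‖k‖ * ‖x - x'‖ * ‖k‖ + ‖k‖ * ‖k‖ * ‖x - x'‖ := by
          refine (norm_add_le _ _).trans (add_le_add ((norm_add_le _ _).trans (add_le_add ?_ ?_)) ?_)
          · exact (norm_mul_le _ _).trans (mul_le_mul_of_nonneg_right (norm_mul_le _ _) (norm_nonneg _))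
          · exact (norm_mul_le _ _).trans (mul_le_mul_of_nonneg_right (norm_mul_le _ _) (norm_nonneg _))
          · exact (norm_mul_le _ _).trans (mul_le_mul_of_nonneg_right (norm_mul_le _ _) (norm_nonneg _))
      _ = 3 * (‖k‖ * ‖k‖) * ‖x - x'‖ := by ring
      _ ≤ 3 * (K * K) * ‖x - x'‖ := by gcongr
      _ ≤ 5 / 6 * (((0 : ℕ) + 3 : ℝ) * ((0 : ℕ) + 2) * ((0 : ℕ) + 1)) * (R + K) ^ 0 * K ^ 2 * ‖x - x'‖ := by
          push_cast
          nlinarith [mul_nonneg (mul_nonneg hK hK) h0]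
  | n + 1 => by
    have hR : 0 ≤ R := (norm_nonneg x).trans hx
    have hK : 0 ≤ K := (norm_nonneg k).trans hk
    have hρ : 0 ≤ R + K := add_nonneg hR hK
    have hxk : ‖x + k‖ ≤ R + K := (norm_add_le _ _).trans (add_le_add hx hk)
    have hx'k : ‖x' + k‖ ≤ R + K := (norm_add_le _ _).trans (add_le_add hx' hk)
    have hxρ : ‖x‖ ≤ R + K := hx.trans (le_add_of_nonneg_right hK)
    have hx'ρ : ‖x'‖ ≤ R + K := hx'.trans (le_add_of_nonneg_right hK)
    have ih := norm_taylorWord_sub_le' hx hx' hk n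
    have hα := norm_taylorWord_le hx hk (n + 1)
    rw [show n + 1 + 3 = n + 3 + 1 from rfl, taylorWord_succ x k (n + 3), taylorWord_succ x' k (n + 3)]
    rw [show n + 1 + 2 = n + 3 from rfl] at hα
    set T := (x + k) ^ (n + 3) - x ^ (n + 3) - ∑ j ∈ range (n + 3), x ^ j * k * x ^ (n + 3 - 1 - j) with hT
    set T' := (x' + k) ^ (n + 3) - x' ^ (n + 3) - ∑ j ∈ range (n + 3), x' ^ j * k * x' ^ (n + 3 - 1 - j) with hT'
    have e : x * T + k * ((x + k) ^ (n + 3) - x ^ (n + 3)) - (x' * T' + k * ((x' + k) ^ (n + 3) - x' ^ (n + 3)))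
        = (x - x') * T + x' * (T - T') + k * (((x + k) ^ (n + 3) - x ^ (n + 3)) - ((x' + k) ^ (n + 3) - x' ^ (n + 3))) := by
      noncomm_ring
    rw [e]
    have hSD0 := norm_pow_secondDiff_le hxk hxρ hx'k hx'ρ (n + 1)
    rw [show n + 1 + 2 = n + 3 from rfl, add_sub_cancel_left, add_sub_cancel_left, sub_self, norm_zero, mul_zero, zero_add,
      add_sub_add_right_eq_sub] at hSD0
    have h0 : 0 ≤ ‖x - x'‖ := norm_nonneg _
    have hSD : ‖((x + k) ^ (n + 3) - x ^ (n + 3)) - ((x' + k) ^ (n + 3) - x' ^ (n + 3))‖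
        ≤ 2 * ((n + 3) * (n + 2)) * (R + K) ^ (n + 1) * K * ‖x - x'‖ := by
      refine hSD0.trans ?_
      push_cast
      have : ((n : ℝ) + 1 + 2) * ((n : ℝ) + 1 + 1) * (R + K) ^ (n + 1) * ‖k‖ * (‖x - x'‖ + ‖x - x'‖)
          ≤ ((n : ℝ) + 1 + 2) * ((n : ℝ) + 1 + 1) * (R + K) ^ (n + 1) * K * (‖x - x'‖ + ‖x - x'‖) :=
        mul_le_mul_of_nonneg_right (mul_le_mul_of_nonneg_left hk (by positivity)) (by positivity)
      linarith
    have hRρ : R * (R + K) ^ n ≤ (R + K) ^ (n + 1) := by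
      rw [pow_succ, mul_comm]
      exact mul_le_mul_of_nonneg_left (le_add_of_nonneg_right hK) (pow_nonneg hρ n)
    have key : 5 / 6 * ((n + 3) * (n + 2) * (n + 1)) * K ^ 2 * ‖x - x'‖ * (R * (R + K) ^ n)
        ≤ 5 / 6 * ((n + 3) * (n + 2) * (n + 1)) * K ^ 2 * ‖x - x'‖ * (R + K) ^ (n + 1) :=
      mul_le_mul_of_nonneg_left hRρ (by positivity)
    calc ‖(x - x') * T + x' * (T - T') + k * (((x + k) ^ (n + 3) - x ^ (n + 3)) - ((x' + k) ^ (n + 3) - x' ^ (n + 3)))‖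
        ≤ ‖x - x'‖ * ‖T‖ + ‖x'‖ * ‖T - T'‖ + ‖k‖ * ‖((x + k) ^ (n + 3) - x ^ (n + 3)) - ((x' + k) ^ (n + 3) - x' ^ (n + 3))‖ :=
          (norm_add_le _ _).trans (add_le_add ((norm_add_le _ _).trans (add_le_add (norm_mul_le _ _) (norm_mul_le _ _)))
            (norm_mul_le _ _))
      _ ≤ ‖x - x'‖ * (((n + 1 : ℕ) + 2 : ℝ) * ((n + 1 : ℕ) + 1) / 2 * (R + K) ^ (n + 1) * K ^ 2)
          + R * (5 / 6 * ((n + 3) * (n + 2) * (n + 1)) * (R + K) ^ n * K ^ 2 * ‖x - x'‖)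
          + K * (2 * ((n + 3) * (n + 2)) * (R + K) ^ (n + 1) * K * ‖x - x'‖) :=
          add_le_add (add_le_add (mul_le_mul_of_nonneg_left hα h0) (mul_le_mul hx' ih (norm_nonneg _) hR))
            (mul_le_mul hk hSD (norm_nonneg _) hK)
      _ ≤ 5 / 6 * (((n + 1 : ℕ) + 3 : ℝ) * ((n + 1 : ℕ) + 2) * ((n + 1 : ℕ) + 1)) * (R + K) ^ (n + 1) * K ^ 2 * ‖x - x'‖ := by
          push_cast
          nlinarith [key]

/-! ## §3 Summation with `1∕n!` -/

omit [NormedAlgebra ℂ E] in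
/-- Shifted factorial majorant: if `f n = 0` for `n < s` and `‖f(n+s)‖ ≤ ρⁿ∕n!·c`, then `f` is summable and `‖Σ f‖ ≤ e^ρ·c`. (bookkeeping) [folklore] -/
theorem summable_and_norm_tsum_le_of_shift {f : ℕ → E} (s : ℕ) {ρ c : ℝ} (h0 : ∀ n < s, f n = 0)
    (hb : ∀ n, ‖f (n + s)‖ ≤ ρ ^ n / n ! * c) : Summable f ∧ ‖∑' n, f n‖ ≤ Real.exp ρ * c := by
  have hreal : HasSum (fun n : ℕ => ρ ^ n / n ! * c) (Real.exp ρ * c) := by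
    have h := exp_series_hasSum_exp' (𝕂 := ℝ) ρ
    rw [← Real.exp_eq_exp_ℝ] at h
    have h' : HasSum (fun n : ℕ => ρ ^ n / n !) (Real.exp ρ) := by simpa [smul_eq_mul, div_eq_inv_mul] using h
    exact h'.mul_right c
  have hs' : Summable fun n => f (n + s) := hreal.summable.of_norm_bounded hb
  have hs : Summable f := (summable_nat_add_iff s).1 hs'
  refine ⟨hs, ?_⟩
  have h1 : HasSum (fun n => f (n + s)) (∑' n, f n) := by
    have h2 := (hasSum_nat_add_iff' s).2 hs.hasSum
    have hz : ∑ i ∈ range s, f i = 0 := sum_eq_zero fun i hi => h0 i (mem_range.1 hi)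
    rwa [hz, sub_zero] at h2
  rw [← h1.tsum_eq]
  exact tsum_of_norm_bounded hreal hb

omit [CompleteSpace E] in
/-- `T_0∕0! = T_1∕1! = 0`. (bookkeeping) [folklore] -/
theorem taylorWord_term_eq_zero (x k : E) :
    ∀ n < 2, (n !⁻¹ : ℂ) • ((x + k) ^ n - x ^ n - ∑ j ∈ range n, x ^ j * k * x ^ (n - 1 - j)) = 0 := by
  intro n hn
  interval_cases n <;> simp

omit [CompleteSpace E] in
/-- `‖(n+2)!⁻¹‖·½(n+2)(n+1)·P = Pⁿ-weight `1∕n!·½`: the factorial bookkeeping `((n+2)!)⁻¹(n+2)(n+1) = (n!)⁻¹`. (bookkeeping) [folklore] -/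
theorem inv_factorial_add_two_mul (n : ℕ) : (((n + 2)! : ℝ))⁻¹ * ((n + 2) * (n + 1)) = ((n ! : ℝ))⁻¹ := by
  have hfac : ((n + 2)! : ℝ) = (n + 2) * ((n + 1) * n !) := by push_cast [Nat.factorial_succ]; ring
  have hk0 : (0 : ℝ) < n ! := by positivity
  rw [hfac]
  field_simp

omit [CompleteSpace E] in
/-- `((n+3)!)⁻¹(n+3)(n+2)(n+1) = (n!)⁻¹`. (bookkeeping) [folklore] -/
theorem inv_factorial_add_three_mul (n : ℕ) : (((n + 3)! : ℝ))⁻¹ * ((n + 3) * (n + 2) * (n + 1)) = ((n ! : ℝ))⁻¹ := by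
  have hfac : ((n + 3)! : ℝ) = (n + 3) * ((n + 2) * ((n + 1) * n !)) := by push_cast [Nat.factorial_succ]; ring
  have hk0 : (0 : ℝ) < n ! := by positivity
  rw [hfac]
  field_simp

omit [CompleteSpace E] in
/-- `‖((m)!⁻¹ : ℂ)‖ = (m!)⁻¹`. (bookkeeping) [folklore] -/
theorem norm_inv_factorial (m : ℕ) : ‖((m ! : ℂ))⁻¹‖ = ((m ! : ℝ))⁻¹ := by
  rw [norm_inv, Complex.norm_natCast]

/-- **THE TAYLOR-2 SERIES OF `exp`**: `Σ_n T_n(x;k)∕n! = e^{x+k} − e^x − dexp x k`. [cite: Hall2015, Thm 5.4] -/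
theorem hasSum_taylorWord {x k : E} {R K : ℝ} (hx : ‖x‖ ≤ R) (hk : ‖k‖ ≤ K) :
    HasSum (fun n : ℕ => (n !⁻¹ : ℂ) • ((x + k) ^ n - x ^ n - ∑ j ∈ range n, x ^ j * k * x ^ (n - 1 - j)))
      (exp (x + k) - exp x - dexp ℂ x k) := by
  have hb : ∀ n : ℕ, ‖(((n + 2) !⁻¹ : ℂ)) • ((x + k) ^ (n + 2) - x ^ (n + 2) - ∑ j ∈ range (n + 2), x ^ j * k * x ^ (n + 2 - 1 - j))‖
      ≤ (R + K) ^ n / n ! * (K ^ 2 / 2) := fun n => by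
    rw [norm_smul, norm_inv_factorial]
    have h := norm_taylorWord_le hx hk n
    calc (((n + 2)! : ℝ))⁻¹ * ‖(x + k) ^ (n + 2) - x ^ (n + 2) - ∑ j ∈ range (n + 2), x ^ j * k * x ^ (n + 2 - 1 - j)‖
        ≤ (((n + 2)! : ℝ))⁻¹ * ((n + 2) * (n + 1) / 2 * (R + K) ^ n * K ^ 2) := mul_le_mul_of_nonneg_left h (by positivity)
      _ = (((n + 2)! : ℝ))⁻¹ * ((n + 2) * (n + 1)) * ((R + K) ^ n * K ^ 2 / 2) := by ring
      _ = (R + K) ^ n / n ! * (K ^ 2 / 2) := by rw [inv_factorial_add_two_mul]; ring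
  obtain ⟨hsT, -⟩ := summable_and_norm_tsum_le_of_shift 2 (taylorWord_term_eq_zero x k) hb
  have hA := exp_series_hasSum_exp' (𝕂 := ℂ) (x + k)
  have hB := exp_series_hasSum_exp' (𝕂 := ℂ) x
  have hL : HasSum (fun n : ℕ => (n !⁻¹ : ℂ) • ∑ j ∈ range n, x ^ j * k * x ^ (n - 1 - j)) (dexp ℂ x k) := by
    have hsum : Summable fun n : ℕ => (n !⁻¹ : ℂ) • ∑ j ∈ range n, x ^ j * k * x ^ (n - 1 - j) := by
      refine ((hA.summable.sub hB.summable).sub hsT).congr fun n => ?_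
      simp only [smul_sub]
      abel
    rw [dexp_apply_eq_tsum]
    exact hsum.hasSum
  simpa only [smul_sub] using (hA.sub hB).sub hL

/-- ★ **SIZE ROW**: `‖e^{x+k} − e^x − dexp x k‖ ≤ e^{R+K}·K²∕2` for `‖x‖ ≤ R`, `‖k‖ ≤ K`. [cite: Hall2015, Thm 5.4] -/
theorem norm_expTaylorTwo_le {x k : E} {R K : ℝ} (hx : ‖x‖ ≤ R) (hk : ‖k‖ ≤ K) :
    ‖exp (x + k) - exp x - dexp ℂ x k‖ ≤ Real.exp (R + K) * (K ^ 2 / 2) := by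
  rw [← (hasSum_taylorWord hx hk).tsum_eq]
  refine (summable_and_norm_tsum_le_of_shift 2 (taylorWord_term_eq_zero x k) fun n => ?_).2
  rw [norm_smul, norm_inv_factorial]
  have h := norm_taylorWord_le hx hk n
  calc (((n + 2)! : ℝ))⁻¹ * ‖(x + k) ^ (n + 2) - x ^ (n + 2) - ∑ j ∈ range (n + 2), x ^ j * k * x ^ (n + 2 - 1 - j)‖
      ≤ (((n + 2)! : ℝ))⁻¹ * ((n + 2) * (n + 1) / 2 * (R + K) ^ n * K ^ 2) := mul_le_mul_of_nonneg_left h (by positivity)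
    _ = (((n + 2)! : ℝ))⁻¹ * ((n + 2) * (n + 1)) * ((R + K) ^ n * K ^ 2 / 2) := by ring
    _ = (R + K) ^ n / n ! * (K ^ 2 / 2) := by rw [inv_factorial_add_two_mul]; ring

/-- ★ **`k`-LIPSCHITZ ROW** (factor `K`): `‖[e^{x+k} − e^x − dexp x k] − [e^{x+k′} − e^x − dexp x k′]‖ ≤ e^{R+K}·K·‖k − k′‖`. [cite: Hall2015, Thm 5.4] -/
theorem norm_expTaylorTwo_sub_expTaylorTwo_le {x k k' : E} {R K : ℝ} (hx : ‖x‖ ≤ R) (hk : ‖k‖ ≤ K) (hk' : ‖k'‖ ≤ K) :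
    ‖(exp (x + k) - exp x - dexp ℂ x k) - (exp (x + k') - exp x - dexp ℂ x k')‖ ≤ Real.exp (R + K) * (K * ‖k - k'‖) := by
  have hs := (hasSum_taylorWord hx hk).sub (hasSum_taylorWord hx hk')
  have hs' : HasSum (fun n : ℕ => (n !⁻¹ : ℂ) • (((x + k) ^ n - x ^ n - ∑ j ∈ range n, x ^ j * k * x ^ (n - 1 - j))
      - ((x + k') ^ n - x ^ n - ∑ j ∈ range n, x ^ j * k' * x ^ (n - 1 - j))))
      ((exp (x + k) - exp x - dexp ℂ x k) - (exp (x + k') - exp x - dexp ℂ x k')) := by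
    simpa only [smul_sub] using hs
  rw [← hs'.tsum_eq]
  refine (summable_and_norm_tsum_le_of_shift 2 (fun n hn => ?_) fun n => ?_).2
  · rw [smul_sub, taylorWord_term_eq_zero x k n hn, taylorWord_term_eq_zero x k' n hn, sub_self]
  · rw [norm_smul, norm_inv_factorial]
    have h := norm_taylorWord_sub_le hx hk hk' n
    calc (((n + 2)! : ℝ))⁻¹ * ‖((x + k) ^ (n + 2) - x ^ (n + 2) - ∑ j ∈ range (n + 2), x ^ j * k * x ^ (n + 2 - 1 - j))
          - ((x + k') ^ (n + 2) - x ^ (n + 2) - ∑ j ∈ range (n + 2), x ^ j * k' * x ^ (n + 2 - 1 - j))‖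
        ≤ (((n + 2)! : ℝ))⁻¹ * ((n + 2) * (n + 1) * (R + K) ^ n * K * ‖k - k'‖) := mul_le_mul_of_nonneg_left h (by positivity)
      _ = (((n + 2)! : ℝ))⁻¹ * ((n + 2) * (n + 1)) * ((R + K) ^ n * (K * ‖k - k'‖)) := by ring
      _ = (R + K) ^ n / n ! * (K * ‖k - k'‖) := by rw [inv_factorial_add_two_mul]; ring

/-- ★★ **`x`-LIPSCHITZ ROW WITH FACTOR `K²`**: `‖[e^{x+k} − e^x − dexp x k] − [e^{x′+k} − e^{x′} − dexp x′ k]‖ ≤ ⅚e^{R+K}·K²·‖x − x′‖`. [cite: Hall2015, Thm 5.4] -/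
theorem norm_expTaylorTwo_sub_expTaylorTwo_le' {x x' k : E} {R K : ℝ} (hx : ‖x‖ ≤ R) (hx' : ‖x'‖ ≤ R) (hk : ‖k‖ ≤ K) :
    ‖(exp (x + k) - exp x - dexp ℂ x k) - (exp (x' + k) - exp x' - dexp ℂ x' k)‖
      ≤ Real.exp (R + K) * (5 / 6 * K ^ 2 * ‖x - x'‖) := by
  have hs := (hasSum_taylorWord hx hk).sub (hasSum_taylorWord hx' hk)
  have hs' : HasSum (fun n : ℕ => (n !⁻¹ : ℂ) • (((x + k) ^ n - x ^ n - ∑ j ∈ range n, x ^ j * k * x ^ (n - 1 - j))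
      - ((x' + k) ^ n - x' ^ n - ∑ j ∈ range n, x' ^ j * k * x' ^ (n - 1 - j))))
      ((exp (x + k) - exp x - dexp ℂ x k) - (exp (x' + k) - exp x' - dexp ℂ x' k)) := by
    simpa only [smul_sub] using hs
  rw [← hs'.tsum_eq]
  refine (summable_and_norm_tsum_le_of_shift 3 (fun n hn => ?_) fun n => ?_).2
  · interval_cases n
    · rw [smul_sub, taylorWord_term_eq_zero x k 0 (by norm_num), taylorWord_term_eq_zero x' k 0 (by norm_num), sub_self]
    · rw [smul_sub, taylorWord_term_eq_zero x k 1 (by norm_num), taylorWord_term_eq_zero x' k 1 (by norm_num), sub_self]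
    · rw [taylorWord_two, taylorWord_two, sub_self, smul_zero]
  · rw [norm_smul, norm_inv_factorial]
    have h := norm_taylorWord_sub_le' hx hx' hk n
    calc (((n + 3)! : ℝ))⁻¹ * ‖((x + k) ^ (n + 3) - x ^ (n + 3) - ∑ j ∈ range (n + 3), x ^ j * k * x ^ (n + 3 - 1 - j))
          - ((x' + k) ^ (n + 3) - x' ^ (n + 3) - ∑ j ∈ range (n + 3), x' ^ j * k * x' ^ (n + 3 - 1 - j))‖
        ≤ (((n + 3)! : ℝ))⁻¹ * (5 / 6 * ((n + 3) * (n + 2) * (n + 1)) * (R + K) ^ n * K ^ 2 * ‖x - x'‖) :=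
          mul_le_mul_of_nonneg_left h (by positivity)
      _ = (((n + 3)! : ℝ))⁻¹ * ((n + 3) * (n + 2) * (n + 1)) * ((R + K) ^ n * (5 / 6 * K ^ 2 * ‖x - x'‖)) := by ring
      _ = (R + K) ^ n / n ! * (5 / 6 * K ^ 2 * ‖x - x'‖) := by rw [inv_factorial_add_three_mul]; ring

end Summit.QuantumFields.YangMills.Theorems.Prop7ExpTaylorTwo

end
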